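import Literature.AlgebraicGeometry.HodgeTheory.WeilSurfaceCMSquare
import Literature.AlgebraicGeometry.HodgeTheory.WeilClassesDescendingOfLefschetzOneOne
import Literature.AlgebraicGeometry.HodgeTheory.IsoTransport
import Literature.AlgebraicGeometry.HodgeTheory.MotivatedClassesAlgebraic
import Literature.AlgebraicGeometry.HodgeTheory.GysinFormalismCorrespondences
import Literature.AlgebraicGeometry.Motives.AimedSplitProductProofs
import HarnessLib

/-!
# The Weil classes of the CM square `E₀ × E₀` are ALGEBRAIC; Schoen's descent partner for it

Family `hodge`, layer `Literature/AlgebraicGeometry/HodgeTheory`. Continuation of `WeilSurfaceCMSquare`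
(`exists_weilType_cmSquare`: for a complex abelian variety `E₀` of dimension `1` with
`ψ₀ ≫ ψ₀ = -(d • 𝟙)`, `d ≥ 1`, the square `B = E₀ × E₀` with `Φ = ψ₀ × (-ψ₀)` is a Weil-type surface
with its pair of Weil classes `u± ∈ E±`). Since the re-cut of 2026-08-16 the partner-surface fact
`exists_weilTypeSurface_prod_isHyperbolicWeilType_all` also asks for Schoen's DESCENT PARTNER of
the surface: an algebraic class `t ∈ N¹H²(B(ℂ); ℂ)` with `u₊ ⌣ t ≠ 0`, `u₋ ⌣ t ≠ 0` (Schoen 1998,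
§10, p. 333: "`W_{A'}` is generated by cohomology classes of divisors"). This file PROVES it for the
CM square, with no appeal to Lefschetz `(1,1)`: **both Weil lines `E₊`, `E₋` of `(E₀ × E₀, Φ)`
consist of algebraic classes** (`weilClassesPlus_cmSquare_le_algebraicClasses`,
`weilClassesMinus_cmSquare_le_algebraicClasses`), whence the partner by
`exists_algebraic_partner_of_algebraic` (`t = u₊ + u₋`; file `WeilClassesDescendingOfLefschetzOneOne`)
— `exists_weilType_cmSquare_partner`, the surface conjunct of the fact VERBATIM for
`A₂ = E₀ × E₀`, `φ₂ = ψ₀ × (-ψ₀)`.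

## Proof (graphs of endomorphisms as shears)

For a homomorphism `f : E₀ → E₀` the SHEAR `σ_f = (pr₁ + f ∘ pr₂, pr₂)` is an automorphism of
`B = E₀ × E₀` (inverse `(pr₁ - f ∘ pr₂, pr₂)`), so `σ_f^*` preserves `N¹H²` (`mem_supportedClasses_map_of_iso`);
the axis classes `pr₁^* η`, `pr₂^* η'` (`η, η' ∈ H²(E₀(ℂ))`, top degree, hence algebraic:
`mem_algebraicClasses_of_degree_top`, `map_fst/snd_mem_supportedClasses`) are algebraic; and on `H¹`
pull-back is additive in the homomorphism (`complexBetti_map_add_deg_one`: `(pr₁ + f pr₂)^* = pr₁^* + pr₂^* f^*`).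
Hence for `a, b ∈ H¹(E₀(ℂ))`, expanding `σ_f^* pr₁^*(a ∪ b) = (pr₁^*a + pr₂^*f^*a) ∪ (pr₁^*b + pr₂^*f^*b)`,
the mixed Künneth component
`D_f(a, b) = pr₁^*a ∪ pr₂^*f^*b + pr₂^*f^*a ∪ pr₁^*b = σ_f^* pr₁^*(a∪b) - pr₁^*(a∪b) - pr₂^*(f^*a ∪ f^*b)`
is ALGEBRAIC (`shearClass_mem_algebraicClasses`; for `f = 𝟙` this is the `H¹ ⊗ H¹`-component of the
diagonal, for `f = ψ₀` of the graph of `ψ₀`). For eigenvectors `ψ₀^* a = λ a`, `ψ₀^* b = μ b` with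
`λ ≠ μ`, `D_{ψ₀}(a,b) - λ D_𝟙(a,b) = (μ - λ) · pr₁^*a ∪ pr₂^*b`, so `pr₁^*a ∪ pr₂^*b` is algebraic
(`cupProduct_map_fst_map_snd_mem_algebraicClasses_of_eigenvector`). With the eigenvectors
`w± = ψ₀^*v ± i√d v` of `WeilSurfaceCMSquare` this gives algebraic generators
`P = pr₁^*w₊ ∪ pr₂^*w₋ ∈ E₊`, `M = pr₁^*w₋ ∪ pr₂^*w₊ ∈ E₋`, non-zero (restrict to the diagonal:
`w₊ ∪ w₋ = 2i√d · v ∪ ψ₀^*v ≠ 0`, `cupProduct_map_one_ne_zero`), and `E±` are the lines they span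
(`weilClassesPlus/Minus_le_span_singleton`, `H• = ⋀•H¹`).

Everything is proved; no definition and no named fact is introduced (D-0026).

## References

* [Schoen1998HodgeWeilAddendum] C. Schoen, Compositio Math. 114 (1998), §10 (proof of the Proposition, p. 333).
* [vanGeemen1994HodgeAV] B. van Geemen, LNM 1594 (1994), 4.9, proof of Lemma 5.2 (6), 5.3.
* [LangeBirkenhake1992] H. Lange, Ch. Birkenhake, Complex Abelian Varieties (1992), 1.1.2, Lemma 1.1.17.
* [GrothendieckTopology1969] A. Grothendieck, Topology 8 (1969), §1 (support filtration).
* [Fulton1998] W. Fulton, Intersection Theory (1998), §19.1–19.2.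
-/

noncomputable section

open CategoryTheory

namespace Literature.AlgebraicGeometry.HodgeTheory

open Literature.AlgebraicTopology.SingularHomology
open Literature.AlgebraicGeometry.Motives
open Literature.Geometry.Kaehler

variable {E₀ : Motives.AbelianVariety ℂ} {d : ℕ} {ψ₀ : E₀ ⟶ E₀}

/-! ### Shears `σ_f = (pr₁ + f pr₂, pr₂)` are automorphisms -/

/-- The shear `σ_f = (pr₁ + f ∘ pr₂, pr₂)` of `E₀ × E₀` followed by `σ_{-f}' = (pr₁ - f ∘ pr₂, pr₂)`
is the identity (computed on the two projections). [cite: LangeBirkenhake1992, 1.1.2] -/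
theorem shear_comp_shear_neg (f : E₀ ⟶ E₀) :
    AbelianVariety.prodLift (AbelianVariety.fst E₀ E₀ + AbelianVariety.snd E₀ E₀ ≫ f)
        (AbelianVariety.snd E₀ E₀) ≫
      AbelianVariety.prodLift (AbelianVariety.fst E₀ E₀ - AbelianVariety.snd E₀ E₀ ≫ f)
        (AbelianVariety.snd E₀ E₀) = 𝟙 (E₀.prod E₀) := by
  refine AbelianVariety.prod_hom_ext ?_ ?_
  · rw [Category.assoc, AbelianVariety.prodLift_fst, Preadditive.comp_sub, AbelianVariety.prodLift_fst,
      ← Category.assoc, AbelianVariety.prodLift_snd, Category.id_comp]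
    abel
  · rw [Category.assoc, AbelianVariety.prodLift_snd, AbelianVariety.prodLift_snd, Category.id_comp]

/-- `σ_{-f}' ≫ σ_f = 𝟙`. [cite: LangeBirkenhake1992, 1.1.2] -/
theorem shear_neg_comp_shear (f : E₀ ⟶ E₀) :
    AbelianVariety.prodLift (AbelianVariety.fst E₀ E₀ - AbelianVariety.snd E₀ E₀ ≫ f)
        (AbelianVariety.snd E₀ E₀) ≫
      AbelianVariety.prodLift (AbelianVariety.fst E₀ E₀ + AbelianVariety.snd E₀ E₀ ≫ f)
        (AbelianVariety.snd E₀ E₀) = 𝟙 (E₀.prod E₀) := by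
  refine AbelianVariety.prod_hom_ext ?_ ?_
  · rw [Category.assoc, AbelianVariety.prodLift_fst, Preadditive.comp_add, AbelianVariety.prodLift_fst,
      ← Category.assoc, AbelianVariety.prodLift_snd, Category.id_comp]
    abel
  · rw [Category.assoc, AbelianVariety.prodLift_snd, AbelianVariety.prodLift_snd, Category.id_comp]

/-- **The shear is an isomorphism of the underlying `ℂ`-schemes.** [cite: LangeBirkenhake1992, 1.1.2] -/
theorem isIso_shear (f : E₀ ⟶ E₀) :
    IsIso (AbelianVariety.prodLift (AbelianVariety.fst E₀ E₀ + AbelianVariety.snd E₀ E₀ ≫ f)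
      (AbelianVariety.snd E₀ E₀)).hom.hom.hom :=
  ⟨⟨(AbelianVariety.prodLift (AbelianVariety.fst E₀ E₀ - AbelianVariety.snd E₀ E₀ ≫ f)
      (AbelianVariety.snd E₀ E₀)).hom.hom.hom,
    by
      change (AbelianVariety.prodLift (AbelianVariety.fst E₀ E₀ + AbelianVariety.snd E₀ E₀ ≫ f)
          (AbelianVariety.snd E₀ E₀) ≫
        AbelianVariety.prodLift (AbelianVariety.fst E₀ E₀ - AbelianVariety.snd E₀ E₀ ≫ f)
          (AbelianVariety.snd E₀ E₀)).hom.hom.hom = (𝟙 (E₀.prod E₀) : E₀.prod E₀ ⟶ E₀.prod E₀).hom.hom.hom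
      rw [shear_comp_shear_neg],
    by
      change (AbelianVariety.prodLift (AbelianVariety.fst E₀ E₀ - AbelianVariety.snd E₀ E₀ ≫ f)
          (AbelianVariety.snd E₀ E₀) ≫
        AbelianVariety.prodLift (AbelianVariety.fst E₀ E₀ + AbelianVariety.snd E₀ E₀ ≫ f)
          (AbelianVariety.snd E₀ E₀)).hom.hom.hom = (𝟙 (E₀.prod E₀) : E₀.prod E₀ ⟶ E₀.prod E₀).hom.hom.hom
      rw [shear_neg_comp_shear]⟩⟩

/-! ### The mixed Künneth component of a shear class is algebraic -/

/-- An axis class `pr₁^* η`, `η ∈ H²(E₀(ℂ); ℂ)` (top degree on the curve `E₀`, hence algebraic), is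
algebraic on `E₀ × E₀`. [cite: Fulton1998, §19.1] [cite: GrothendieckTopology1969, §1] -/
theorem map_fst_two_mem_algebraicClasses (hE : E₀.dim = 1) (η : complexBetti E₀.X (2 * 1)) :
    complexBetti.map (AbelianVariety.fst E₀ E₀).hom.hom.hom (2 * 1) η ∈
      algebraicClasses (E₀.prod E₀).X 1 := by
  have hX : Motives.IsSmoothProjective 1 E₀.X := isSmoothProjective_of_dim_eq' hE
  have hη : η ∈ algebraicClasses E₀.X 1 := mem_algebraicClasses_of_degree_top hX le_rfl η
  exact map_fst_mem_supportedClasses hX hX hη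

/-- The same for `pr₂^* η`. [cite: Fulton1998, §19.1] [cite: GrothendieckTopology1969, §1] -/
theorem map_snd_two_mem_algebraicClasses (hE : E₀.dim = 1) (η : complexBetti E₀.X (2 * 1)) :
    complexBetti.map (AbelianVariety.snd E₀ E₀).hom.hom.hom (2 * 1) η ∈
      algebraicClasses (E₀.prod E₀).X 1 := by
  have hX : Motives.IsSmoothProjective 1 E₀.X := isSmoothProjective_of_dim_eq' hE
  have hη : η ∈ algebraicClasses E₀.X 1 := mem_algebraicClasses_of_degree_top hX le_rfl η
  exact map_snd_mem_supportedClasses hX hX hη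

/-- **The mixed Künneth component of a shear class is algebraic**: for `f : E₀ → E₀` and
`a, b ∈ H¹(E₀(ℂ); ℂ)`,
`D_f(a,b) = pr₁^*a ∪ pr₂^*(f^*b) + pr₂^*(f^*a) ∪ pr₁^*b = σ_f^* pr₁^*(a ∪ b) - pr₁^*(a ∪ b) - pr₂^*(f^*a ∪ f^*b)`
lies in `N¹H²((E₀ × E₀)(ℂ); ℂ)` — the shear `σ_f = (pr₁ + f pr₂, pr₂)` is an automorphism
(`isIso_shear`, `mem_supportedClasses_map_of_iso`), `(pr₁ + f pr₂)^* = pr₁^* + pr₂^* f^*` on `H¹`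
(`complexBetti_map_add_deg_one`) and the cup product is natural. (`f = 𝟙`: the `H¹ ⊗ H¹`-component
of the diagonal class; `f = ψ₀`: of the graph of `ψ₀`.) [cite: LangeBirkenhake1992, 1.1.2 and Lemma 1.1.17]
[cite: GrothendieckTopology1969, §1] -/
theorem shearClass_mem_algebraicClasses (hE : E₀.dim = 1) (f : E₀ ⟶ E₀) (a b : complexBetti E₀.X 1) :
    cupProduct (show 1 + 1 = 2 * 1 from rfl) (complexBetti.map (AbelianVariety.fst E₀ E₀).hom.hom.hom 1 a)
        (complexBetti.map (AbelianVariety.snd E₀ E₀).hom.hom.hom 1 (complexBetti.map f.hom.hom.hom 1 b)) +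
      cupProduct (show 1 + 1 = 2 * 1 from rfl)
        (complexBetti.map (AbelianVariety.snd E₀ E₀).hom.hom.hom 1 (complexBetti.map f.hom.hom.hom 1 a))
        (complexBetti.map (AbelianVariety.fst E₀ E₀).hom.hom.hom 1 b) ∈
      algebraicClasses (E₀.prod E₀).X 1 := by
  set B := E₀.prod E₀ with hB
  set p₁ := AbelianVariety.fst E₀ E₀ with hp₁
  set p₂ := AbelianVariety.snd E₀ E₀ with hp₂
  set σ : B ⟶ B := AbelianVariety.prodLift (p₁ + p₂ ≫ f) p₂ with hσ
  set X1 := (complexBetti.map p₁.hom.hom.hom 1).hom with hX1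
  set Y1 := (complexBetti.map p₂.hom.hom.hom 1).hom with hY1
  set F1 := (complexBetti.map f.hom.hom.hom 1).hom with hF1
  set P := cupProduct (X := Motives.ComplexPoints B.X) (R := ℂ) (show 1 + 1 = 2 * 1 from rfl) with hP
  set P₀ := cupProduct (X := Motives.ComplexPoints E₀.X) (R := ℂ) (show 1 + 1 = 2 * 1 from rfl) with hP₀
  -- the three algebraic classes
  have h1 : complexBetti.map σ.hom.hom.hom (2 * 1) (complexBetti.map p₁.hom.hom.hom (2 * 1) (P₀ a b)) ∈
      algebraicClasses B.X 1 := by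
    haveI := isIso_shear f
    have h := mem_supportedClasses_map_of_iso (asIso σ.hom.hom.hom) (map_fst_two_mem_algebraicClasses hE (P₀ a b))
    rwa [asIso_hom] at h
  have h2 : complexBetti.map p₁.hom.hom.hom (2 * 1) (P₀ a b) ∈ algebraicClasses B.X 1 :=
    map_fst_two_mem_algebraicClasses hE _
  have h3 : complexBetti.map p₂.hom.hom.hom (2 * 1) (P₀ (F1 a) (F1 b)) ∈ algebraicClasses B.X 1 :=
    map_snd_two_mem_algebraicClasses hE _
  -- the expansion of `σ^* pr₁^*(a ∪ b)`
  have hσ1 : ∀ c : complexBetti E₀.X 1,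
      complexBetti.map σ.hom.hom.hom 1 (X1 c) = X1 c + Y1 (F1 c) := by
    intro c
    change complexBetti.map σ.hom.hom.hom 1 (complexBetti.map p₁.hom.hom.hom 1 c) = _
    rw [complexBetti_map_map_hom, hσ, AbelianVariety.prodLift_fst, complexBetti_map_add_deg_one,
      ← complexBetti_map_map_hom]
  have hexp : complexBetti.map σ.hom.hom.hom (2 * 1) (complexBetti.map p₁.hom.hom.hom (2 * 1) (P₀ a b)) =
      complexBetti.map p₁.hom.hom.hom (2 * 1) (P₀ a b) +
        (P (X1 a) (Y1 (F1 b)) + P (Y1 (F1 a)) (X1 b)) +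
        complexBetti.map p₂.hom.hom.hom (2 * 1) (P₀ (F1 a) (F1 b)) := by
    have e1 : complexBetti.map p₁.hom.hom.hom (2 * 1) (P₀ a b) = P (X1 a) (X1 b) := cupProduct_map _ _ a b
    have e2 : complexBetti.map p₂.hom.hom.hom (2 * 1) (P₀ (F1 a) (F1 b)) = P (Y1 (F1 a)) (Y1 (F1 b)) :=
      cupProduct_map _ _ _ _
    rw [e1, e2]
    rw [show complexBetti.map σ.hom.hom.hom (2 * 1) (P (X1 a) (X1 b)) =
        P (complexBetti.map σ.hom.hom.hom 1 (X1 a)) (complexBetti.map σ.hom.hom.hom 1 (X1 b)) from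
      cupProduct_map _ _ _ _, hσ1, hσ1]
    simp only [map_add, LinearMap.add_apply]
    abel
  have hD : P (X1 a) (Y1 (F1 b)) + P (Y1 (F1 a)) (X1 b) =
      complexBetti.map σ.hom.hom.hom (2 * 1) (complexBetti.map p₁.hom.hom.hom (2 * 1) (P₀ a b)) -
        complexBetti.map p₁.hom.hom.hom (2 * 1) (P₀ a b) -
        complexBetti.map p₂.hom.hom.hom (2 * 1) (P₀ (F1 a) (F1 b)) := by
    rw [hexp]; abel
  change P (X1 a) (Y1 (F1 b)) + P (Y1 (F1 a)) (X1 b) ∈ algebraicClasses B.X 1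
  rw [hD]
  exact Submodule.sub_mem _ (Submodule.sub_mem _ h1 h2) h3

/-- **`pr₁^*a ∪ pr₂^*b` is algebraic for `ψ₀^*`-eigenvectors `a`, `b` with distinct eigenvalues**:
`D_{ψ₀}(a,b) - λ D_𝟙(a,b) = (μ - λ) pr₁^*a ∪ pr₂^*b` for `ψ₀^*a = λ a`, `ψ₀^*b = μ b`.
[cite: vanGeemen1994HodgeAV, proof of Lemma 5.2 (6)] [cite: LangeBirkenhake1992, 1.1.2] -/
theorem cupProduct_map_fst_map_snd_mem_algebraicClasses_of_eigenvector (hE : E₀.dim = 1)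
    (ψ₀ : E₀ ⟶ E₀) {a b : complexBetti E₀.X 1} {lam mu : ℂ}
    (ha : complexBetti.map ψ₀.hom.hom.hom 1 a = lam • a) (hb : complexBetti.map ψ₀.hom.hom.hom 1 b = mu • b)
    (hne : lam ≠ mu) :
    cupProduct (show 1 + 1 = 2 * 1 from rfl) (complexBetti.map (AbelianVariety.fst E₀ E₀).hom.hom.hom 1 a)
        (complexBetti.map (AbelianVariety.snd E₀ E₀).hom.hom.hom 1 b) ∈
      algebraicClasses (E₀.prod E₀).X 1 := by
  set X1 := (complexBetti.map (AbelianVariety.fst E₀ E₀).hom.hom.hom 1).hom with hX1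
  set Y1 := (complexBetti.map (AbelianVariety.snd E₀ E₀).hom.hom.hom 1).hom with hY1
  set P := cupProduct (X := Motives.ComplexPoints (E₀.prod E₀).X) (R := ℂ) (show 1 + 1 = 2 * 1 from rfl)
    with hP
  -- `D_𝟙 = P(Xa, Yb) + P(Ya, Xb)` and `D_ψ = μ P(Xa, Yb) + λ P(Ya, Xb)` are algebraic
  have hid : ∀ c : complexBetti E₀.X 1, complexBetti.map (𝟙 E₀ : E₀ ⟶ E₀).hom.hom.hom 1 c = c := by
    intro c
    change complexBetti.map (𝟙 E₀.X) 1 c = c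
    rw [complexBetti.map_id]
    rfl
  have h1 := shearClass_mem_algebraicClasses hE (𝟙 E₀) a b
  rw [hid, hid] at h1
  have h2 := shearClass_mem_algebraicClasses hE ψ₀ a b
  rw [ha, hb] at h2
  simp only [map_smul, LinearMap.smul_apply] at h2
  change P (X1 a) (Y1 b) + P (Y1 a) (X1 b) ∈ _ at h1
  change mu • P (X1 a) (Y1 b) + lam • P (Y1 a) (X1 b) ∈ _ at h2
  -- `(μ - λ) P(Xa, Yb) = D_ψ - λ D_𝟙`
  have h3 : (mu - lam) • P (X1 a) (Y1 b) =
      (mu • P (X1 a) (Y1 b) + lam • P (Y1 a) (X1 b)) - lam • (P (X1 a) (Y1 b) + P (Y1 a) (X1 b)) := by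
    rw [sub_smul, smul_add]; abel
  have h4 : (mu - lam) • P (X1 a) (Y1 b) ∈ algebraicClasses (E₀.prod E₀).X 1 := by
    rw [h3]
    exact Submodule.sub_mem _ h2 (Submodule.smul_mem _ _ h1)
  have hml : mu - lam ≠ 0 := sub_ne_zero.2 (Ne.symm hne)
  have h5 := Submodule.smul_mem _ (mu - lam)⁻¹ h4
  rwa [smul_smul, inv_mul_cancel₀ hml, one_smul] at h5

/-! ### The Weil lines of the CM square are algebraic -/

/-- **Algebraic non-zero generators of the two Weil lines of `(E₀ × E₀, ψ₀ × (-ψ₀))`**: with the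
eigenvectors `w± = ψ₀^*v ± i√d·v` of `ψ₀^*` on `H¹(E₀(ℂ); ℂ)` (`v ≠ 0` rational), the classes
`P = pr₁^*w₊ ∪ pr₂^*w₋ ∈ E₊` and `M = pr₁^*w₋ ∪ pr₂^*w₊ ∈ E₋` are algebraic
(`cupProduct_map_fst_map_snd_mem_algebraicClasses_of_eigenvector`, eigenvalues `± i√d`) and
non-zero (their restrictions to the diagonal are `± w₊ ∪ w₋ = ± 2i√d · v ∪ ψ₀^*v ≠ 0`).
[cite: vanGeemen1994HodgeAV, proof of Lemma 5.2 (6) and 5.3] [cite: Schoen1998HodgeWeilAddendum, §10] -/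
theorem exists_algebraic_generators_weilLines_cmSquare (hE : E₀.dim = 1) (hd : 0 < d)
    (hψ : ψ₀ ≫ ψ₀ = -(d • 𝟙 E₀)) :
    ∃ P M : complexBetti (E₀.prod E₀).X (2 * 1),
      P ∈ weilClassesPlus (E₀.prod E₀)
          (AbelianVariety.prodLift (AbelianVariety.fst E₀ E₀ ≫ ψ₀) (AbelianVariety.snd E₀ E₀ ≫ (-ψ₀))) 1 d ∧
      M ∈ weilClassesMinus (E₀.prod E₀)
          (AbelianVariety.prodLift (AbelianVariety.fst E₀ E₀ ≫ ψ₀) (AbelianVariety.snd E₀ E₀ ≫ (-ψ₀))) 1 d ∧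
      P ∈ algebraicClasses (E₀.prod E₀).X 1 ∧ M ∈ algebraicClasses (E₀.prod E₀).X 1 ∧
      P ≠ 0 ∧ M ≠ 0 := by
  classical
  set B := E₀.prod E₀ with hB
  set Φ : B ⟶ B := AbelianVariety.prodLift (AbelianVariety.fst E₀ E₀ ≫ ψ₀)
    (AbelianVariety.snd E₀ E₀ ≫ (-ψ₀)) with hΦ
  set T := (complexBetti.map ψ₀.hom.hom.hom 1).hom with hTdef
  have hT2 : ∀ c, T (T c) = -((d : ℂ) • c) := fun c ↦ complexBetti_map_map_one_of_comp_self hψ c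
  set s : ℂ := Complex.I * (Real.sqrt d : ℂ) with hs
  have hs2 : s * s = -(d : ℂ) := by rw [← sq, hs, I_mul_sqrt_sq]
  have hs0 : s ≠ 0 := I_mul_sqrt_ne_zero hd
  -- the rational class `v` and the eigenvectors `w± = Tv ± s v`
  obtain ⟨v, hv, hv0⟩ := exists_isRationalClass_ne_zero_one hE
  set wp : complexBetti E₀.X 1 := T v + s • v with hwp
  set wm : complexBetti E₀.X 1 := T v - s • v with hwm
  have hTwp : T wp = s • wp := by
    rw [hwp, map_add, map_smul, hT2, smul_add, smul_smul, hs2, neg_smul, add_comm]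
  have hTwm : T wm = (-s) • wm := by
    rw [hwm, map_sub, map_smul, hT2, smul_sub, smul_smul, neg_mul, hs2, neg_neg, neg_smul]
    abel
  have hsne : s ≠ -s := fun h ↦ hs0 (by
    have : (2 : ℂ) * s = 0 := by rw [two_mul]; nth_rewrite 2 [h]; rw [add_neg_cancel]
    exact (mul_eq_zero.1 this).resolve_left two_ne_zero)
  -- the classes `P`, `M`
  set Xf := (complexBetti.map (AbelianVariety.fst E₀ E₀).hom.hom.hom 1).hom with hXf
  set Yf := (complexBetti.map (AbelianVariety.snd E₀ E₀).hom.hom.hom 1).hom with hYf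
  set Pc := cupProduct (X := Motives.ComplexPoints B.X) (R := ℂ) (show 1 + 1 = 2 * 1 from rfl) with hPc
  set P : complexBetti B.X (2 * 1) := Pc (Xf wp) (Yf wm) with hPdef
  set M : complexBetti B.X (2 * 1) := Pc (Xf wm) (Yf wp) with hMdef
  -- algebraicity
  have hPalg : P ∈ algebraicClasses B.X 1 :=
    cupProduct_map_fst_map_snd_mem_algebraicClasses_of_eigenvector hE ψ₀ hTwp hTwm hsne
  have hMalg : M ∈ algebraicClasses B.X 1 :=
    cupProduct_map_fst_map_snd_mem_algebraicClasses_of_eigenvector hE ψ₀ hTwm hTwp (Ne.symm hsne)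
  -- the Weil typing (as in `exists_weilType_cmSquare`)
  have hp₁ : AbelianVariety.fst E₀ E₀ ≫ ψ₀ = Φ ≫ AbelianVariety.fst E₀ E₀ :=
    (AbelianVariety.prodLift_fst _ _).symm
  have hp₂ : AbelianVariety.snd E₀ E₀ ≫ (-ψ₀) = Φ ≫ AbelianVariety.snd E₀ E₀ :=
    (AbelianVariety.prodLift_snd _ _).symm
  have hnegT : ∀ c, complexBetti.map (-ψ₀).hom.hom.hom 1 c = -(T c) := fun c ↦ by
    rw [complexBetti_map_neg_one]; rfl
  have hwp_plus : wp ∈ pullbackEigenclasses E₀ ψ₀ 1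
      (fun x y ↦ (x : ℂ) + (y : ℂ) * Complex.I * (Real.sqrt d : ℂ)) := by
    rw [pullbackEigenclasses_one_eq_eigenspace]
    exact Module.End.mem_eigenspace_iff.2 hTwp
  have hwm_minus : wm ∈ pullbackEigenclasses E₀ ψ₀ 1
      (fun x y ↦ (x : ℂ) - (y : ℂ) * Complex.I * (Real.sqrt d : ℂ)) := by
    rw [pullbackEigenclasses_one_eq_eigenspace_neg]
    exact Module.End.mem_eigenspace_iff.2 hTwm
  have hwm_plus' : wm ∈ pullbackEigenclasses E₀ (-ψ₀) 1
      (fun x y ↦ (x : ℂ) + (y : ℂ) * Complex.I * (Real.sqrt d : ℂ)) := by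
    rw [pullbackEigenclasses_one_eq_eigenspace, Module.End.mem_eigenspace_iff]
    change complexBetti.map (-ψ₀).hom.hom.hom 1 wm = s • wm
    rw [hnegT, hTwm, neg_smul, neg_neg]
  have hwp_minus' : wp ∈ pullbackEigenclasses E₀ (-ψ₀) 1
      (fun x y ↦ (x : ℂ) - (y : ℂ) * Complex.I * (Real.sqrt d : ℂ)) := by
    rw [pullbackEigenclasses_one_eq_eigenspace_neg, Module.End.mem_eigenspace_iff]
    change complexBetti.map (-ψ₀).hom.hom.hom 1 wp = (-s) • wp
    rw [hnegT, hTwp, neg_smul]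
  have hP_mem : P ∈ weilClassesPlus B Φ 1 d := by
    have h := cupProduct_map_map_mem_pullbackEigenclasses hp₁ hp₂ (show 1 + 1 = 2 * 1 from rfl)
      hwp_plus hwm_plus'
    rw [mem_weilClassesPlus_iff]
    intro x y
    have h' := (mem_pullbackEigenclasses_iff.1 h) x y
    rw [h']
    congr 1
    ring
  have hM_mem : M ∈ weilClassesMinus B Φ 1 d := by
    have h := cupProduct_map_map_mem_pullbackEigenclasses hp₁ hp₂ (show 1 + 1 = 2 * 1 from rfl)
      hwm_minus hwp_minus'
    rw [mem_weilClassesMinus_iff]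
    intro x y
    have h' := (mem_pullbackEigenclasses_iff.1 h) x y
    rw [h']
    congr 1
    ring
  -- non-vanishing: restrict to the diagonal `Δ = (𝟙, 𝟙)`
  set Δ : E₀ ⟶ B := AbelianVariety.prodLift (𝟙 E₀) (𝟙 E₀) with hΔ
  set G := (complexBetti.map Δ.hom.hom.hom (2 * 1)).hom with hG
  set G1 := (complexBetti.map Δ.hom.hom.hom 1).hom with hG1
  set P' := cupProduct (X := Motives.ComplexPoints E₀.X) (R := ℂ) (show 1 + 1 = 2 * 1 from rfl) with hP'
  have hid : ∀ c : complexBetti E₀.X 1, complexBetti.map (𝟙 E₀ : E₀ ⟶ E₀).hom.hom.hom 1 c = c := by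
    intro c
    change complexBetti.map (𝟙 E₀.X) 1 c = c
    rw [complexBetti.map_id]
    rfl
  have hGX : ∀ a, G1 (Xf a) = a := fun a ↦ by
    change complexBetti.map Δ.hom.hom.hom 1 (complexBetti.map (AbelianVariety.fst E₀ E₀).hom.hom.hom 1 a) = a
    rw [complexBetti_map_map_hom, hΔ, AbelianVariety.prodLift_fst, hid]
  have hGY : ∀ a, G1 (Yf a) = a := fun a ↦ by
    change complexBetti.map Δ.hom.hom.hom 1 (complexBetti.map (AbelianVariety.snd E₀ E₀).hom.hom.hom 1 a) = a
    rw [complexBetti_map_map_hom, hΔ, AbelianVariety.prodLift_snd, hid]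
  have hGP : ∀ a b, G (Pc a b) = P' (G1 a) (G1 b) := fun a b ↦ cupProduct_map _ _ a b
  have hvv : P' v v = 0 := cup_self_deg_one v
  have htt : P' (T v) (T v) = 0 := cup_self_deg_one (T v)
  have htv : P' (T v) v = -P' v (T v) := by
    have h := cupProduct_gradedComm_holds ℂ (Motives.ComplexPoints E₀.X) (show 1 + 1 = 2 * 1 from rfl)
      rfl (T v) v
    simpa using h
  have hvt : P' v (T v) ≠ 0 := cupProduct_map_one_ne_zero hE hd hψ hv hv0
  have h2s : (2 : ℂ) * s ≠ 0 := mul_ne_zero two_ne_zero hs0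
  have hwpwm : P' wp wm = ((2 : ℂ) * s) • P' v (T v) := by
    rw [hwp, hwm]
    simp only [map_add, map_sub, map_smul, LinearMap.add_apply, LinearMap.smul_apply, hvv, htt, htv]
    module
  have hwmwp : P' wm wp = -(((2 : ℂ) * s) • P' v (T v)) := by
    rw [hwp, hwm]
    simp only [map_add, map_sub, map_smul, LinearMap.sub_apply, LinearMap.smul_apply, hvv, htt, htv]
    module
  have hP0 : P ≠ 0 := by
    intro h0
    have h1 : G P = P' wp wm := by rw [hPdef, hGP, hGX, hGY]
    rw [h0, map_zero, hwpwm] at h1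
    exact (smul_ne_zero h2s hvt) h1.symm
  have hM0 : M ≠ 0 := by
    intro h0
    have h1 : G M = P' wm wp := by rw [hMdef, hGP, hGX, hGY]
    rw [h0, map_zero, hwmwp] at h1
    exact (neg_ne_zero.2 (smul_ne_zero h2s hvt)) h1.symm
  exact ⟨P, M, hP_mem, hM_mem, hPalg, hMalg, hP0, hM0⟩

/-- **The `+`-Weil line of the CM square consists of algebraic classes.**
[cite: Schoen1998HodgeWeilAddendum, §10 (p. 333)] [cite: vanGeemen1994HodgeAV, proof of Lemma 5.2 (6)] -/
theorem weilClassesPlus_cmSquare_le_algebraicClasses (hE : E₀.dim = 1) (hd : 0 < d)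
    (hψ : ψ₀ ≫ ψ₀ = -(d • 𝟙 E₀)) :
    weilClassesPlus (E₀.prod E₀)
        (AbelianVariety.prodLift (AbelianVariety.fst E₀ E₀ ≫ ψ₀) (AbelianVariety.snd E₀ E₀ ≫ (-ψ₀))) 1 d ≤
      algebraicClasses (E₀.prod E₀).X 1 := by
  obtain ⟨P, M, hP, -, hPalg, -, hP0, -⟩ := exists_algebraic_generators_weilLines_cmSquare hE hd hψ
  have hb₁ : Module.finrank ℂ (complexBetti (E₀.prod E₀).X 1) = 2 * (2 * 1) :=
    finrank_complexBetti_one_of_dim_eq_two (dim_cmSquare hE)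
  intro c hc
  obtain ⟨α, rfl⟩ := Submodule.mem_span_singleton.mp
    (weilClassesPlus_le_span_singleton (surface_hasExteriorCohomologyH1 (E₀.prod E₀)) hb₁ hd
      (cmSquare_comp_self hψ) hP hP0 hc)
  exact Submodule.smul_mem _ _ hPalg

/-- **The `-`-Weil line of the CM square consists of algebraic classes.**
[cite: Schoen1998HodgeWeilAddendum, §10 (p. 333)] [cite: vanGeemen1994HodgeAV, proof of Lemma 5.2 (6)] -/
theorem weilClassesMinus_cmSquare_le_algebraicClasses (hE : E₀.dim = 1) (hd : 0 < d)
    (hψ : ψ₀ ≫ ψ₀ = -(d • 𝟙 E₀)) :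
    weilClassesMinus (E₀.prod E₀)
        (AbelianVariety.prodLift (AbelianVariety.fst E₀ E₀ ≫ ψ₀) (AbelianVariety.snd E₀ E₀ ≫ (-ψ₀))) 1 d ≤
      algebraicClasses (E₀.prod E₀).X 1 := by
  obtain ⟨P, M, -, hM, -, hMalg, -, hM0⟩ := exists_algebraic_generators_weilLines_cmSquare hE hd hψ
  have hb₁ : Module.finrank ℂ (complexBetti (E₀.prod E₀).X 1) = 2 * (2 * 1) :=
    finrank_complexBetti_one_of_dim_eq_two (dim_cmSquare hE)
  intro c hc
  obtain ⟨α, rfl⟩ := Submodule.mem_span_singleton.mp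
    (weilClassesMinus_le_span_singleton (surface_hasExteriorCohomologyH1 (E₀.prod E₀)) hb₁ hd
      (cmSquare_comp_self hψ) hM hM0 hc)
  exact Submodule.smul_mem _ _ hMalg

/-! ### The surface conjunct of the partner-surface fact for the CM square -/

/-- **The CM square as the partner surface, with Schoen's descent partner.** For `E₀` of dimension
`1` with `ψ₀ ≫ ψ₀ = -(d • 𝟙 E₀)`, `d ≥ 1`: `B = E₀ × E₀` with `Φ = ψ₀ × (-ψ₀)` has dimension `2·1`,
is smooth projective, `Φ ≫ Φ = -(d • 𝟙)`, and carries `u₊ ∈ E₊`, `u₋ ∈ E₋`, both non-zero, with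
`u₊ + u₋` rational of Hodge type `(1,1)` (`exists_weilType_cmSquare`) AND an algebraic class `t`
with `u₊ ⌣ t ≠ 0`, `u₋ ⌣ t ≠ 0` (`t = u₊ + u₋`, algebraic by
`weilClassesPlus/Minus_cmSquare_le_algebraicClasses`; `exists_algebraic_partner_of_algebraic`) — the
surface conjunct of `exists_weilTypeSurface_prod_isHyperbolicWeilType_all` VERBATIM for
`A₂ = E₀ × E₀`, `φ₂ = ψ₀ × (-ψ₀)`. [cite: Schoen1998HodgeWeilAddendum, §10 (proof of the Proposition, p. 333)]
[cite: vanGeemen1994HodgeAV, 5.3] -/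
theorem exists_weilType_cmSquare_partner (hE : E₀.dim = 1) (hd : 0 < d) (hψ : ψ₀ ≫ ψ₀ = -(d • 𝟙 E₀)) :
    (E₀.prod E₀).dim = 2 * 1 ∧ Motives.IsSmoothProjective (2 * 1) (E₀.prod E₀).X ∧
      AbelianVariety.prodLift (AbelianVariety.fst E₀ E₀ ≫ ψ₀) (AbelianVariety.snd E₀ E₀ ≫ (-ψ₀)) ≫
          AbelianVariety.prodLift (AbelianVariety.fst E₀ E₀ ≫ ψ₀) (AbelianVariety.snd E₀ E₀ ≫ (-ψ₀)) =
        -(d • 𝟙 (E₀.prod E₀)) ∧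
      ∃ up um : complexBetti (E₀.prod E₀).X (2 * 1),
        up ∈ weilClassesPlus (E₀.prod E₀)
          (AbelianVariety.prodLift (AbelianVariety.fst E₀ E₀ ≫ ψ₀) (AbelianVariety.snd E₀ E₀ ≫ (-ψ₀))) 1 d ∧
        um ∈ weilClassesMinus (E₀.prod E₀)
          (AbelianVariety.prodLift (AbelianVariety.fst E₀ E₀ ≫ ψ₀) (AbelianVariety.snd E₀ E₀ ≫ (-ψ₀))) 1 d ∧
        IsRationalClass (up + um) ∧ IsOfHodgeType (2 * 1) (E₀.prod E₀).X (2 * 1) 1 1 (up + um) ∧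
        up ≠ 0 ∧ um ≠ 0 ∧
        ∃ t : complexBetti (E₀.prod E₀).X (2 * 1), t ∈ algebraicClasses (E₀.prod E₀).X 1 ∧
          cupProduct (show 2 * 1 + 2 * 1 = 2 * (2 * 1) from rfl) up t ≠ 0 ∧
          cupProduct (show 2 * 1 + 2 * 1 = 2 * (2 * 1) from rfl) um t ≠ 0 := by
  obtain ⟨h1, h2, h3, up, um, hup, hum, hrat, htyp, hup0, hum0⟩ := exists_weilType_cmSquare hE hd hψ
  have hN : up + um ∈ algebraicClasses (E₀.prod E₀).X 1 :=
    Submodule.add_mem _ (weilClassesPlus_cmSquare_le_algebraicClasses hE hd hψ hup)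
      (weilClassesMinus_cmSquare_le_algebraicClasses hE hd hψ hum)
  have hB : (E₀.prod E₀).dim = 2 := dim_cmSquare hE
  obtain ⟨t, ht, hupt, humt⟩ := exists_algebraic_partner_of_algebraic hd hB h3 hup hum hup0 hum0 hN
  exact ⟨h1, h2, h3, up, um, hup, hum, hrat, htyp, hup0, hum0, t, ht, hupt, humt⟩

end Literature.AlgebraicGeometry.HodgeTheory

end
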